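import Literature.NumberTheory.Transcendental.KZCalculusProofs
import Literature.NumberTheory.Transcendental.SemialgebraicMapsProofs
import Literature.NumberTheory.Transcendental.KZSemialgebraicComplex
import Literature.NumberTheory.Transcendental.SemialgebraicRpow
import Literature.NumberTheory.Transcendental.KZCubeProducts
import Mathlib.MeasureTheory.Function.Jacobian

/-!
# `CompleteModGammaSector` (stmt-KontsevichZagierPeriods-14233) — line `cusp-transport-to-the-beta-world`,
third engine client (the `LegendreSector` chain), stub `stub_legendreSquareCoV` (link S1)

**Legendre's form on the open square is one change of variables away from a quarter of the
Elliott integrand.** For a real algebraic modulus `m ∈ (0,1)` let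
`F(m; x, y) = κₘ(x) e_{1−m}(y) + eₘ(x) κ_{1−m}(y) − κₘ(x) κ_{1−m}(y)` be Legendre's form
(`κₘ(x) = 1/√((1−x²)(1−mx²))`, `eₘ(x) = √(1−mx²)/√(1−x²)`), whose integral over `(0,1)²` is
`EK′ + E′K − KK′`. The coordinatewise square `Φ(x, y) = (x², y²)` is a `ℚ`-polynomial map,
injective on `(0,1)²` with image `(0,1)²`, derivative `diag(2x, 2y)` and Jacobian `4xy > 0`;
since `κₘ(√t) = (1−t)^{−1/2}(1−mt)^{−1/2}`, `eₘ(√t) = (1−mt) κₘ(√t)` and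
`e κ' + κ e' − κ κ' = κ κ' (B + D − 1)` (`B = 1 − mt`, `D = 1 − (1−m)u`), the pull-back identity
reads `F(m; x, y) = ¼ K(x², y²) (1 − m x² − (1−m) y²) · 4xy` with the Elliott kernel
`K(t,u) = t^{−1/2}(1−t)^{−1/2}(1−mt)^{−1/2} u^{−1/2}(1−u)^{−1/2}(1−(1−m)u)^{−1/2}`. Hence, by ONE
move of rule (2) of the Kontsevich–Zagier calculus, `[(0,1)², F(m; ·)]` is equivalent to
`[(0,1)², ¼ K · (1 − mt − (1−m)u)]`; the target representation is assembled inside the proof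
(its integrand is `ℚ`-semialgebraic as a product of rational powers of positive `ℚ(m)`-affine
functions, `IsSemialgebraicFunOn.rpow_ratCast`, and its absolute integrability is transported
from the source by `MeasureTheory.integrableOn_image_iff_integrableOn_abs_det_fderiv_smul`).
Pattern of `TerasomaMultiplicationCompleteModGammaSectorStubEulerInvolutionMove.lean`.

References: M. Kontsevich, D. Zagier, *Periods* (2001), §1.2 rule (2) and the discussion of
Legendre's relation; J. Bochnak, M. Coste, M.-F. Roy, *Real Algebraic Geometry* (1998), Prop. 2.2.6.
-/

noncomputable section

-- `Summit.KontsevichZagierPeriods.KontsevichZagierPeriods.…` is the tree's mandated layout (single-conjunct summit).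
set_option linter.dupNamespace false

namespace Summit.KontsevichZagierPeriods.KontsevichZagierPeriods.CompleteModGammaSectorEngine

open MeasureTheory Set
open Literature.NumberTheory.Transcendental
open Literature.NumberTheory.Transcendental.KZ
open Literature.ModelTheory.ExponentialFields (IsSemialgebraic)
open MvPolynomial (aeval X C)

/-! ## Scalar algebra of the pull-back -/

/-- `u^{−1/2} = (√u)⁻¹` for `u ≥ 0`. [folklore] -/
private theorem rpow_neg_half {u : ℝ} (hu : 0 ≤ u) : u ^ (-(1 / 2 : ℝ)) = (Real.sqrt u)⁻¹ := by
  rw [Real.rpow_neg hu, Real.sqrt_eq_rpow]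

/-- `(a²)^{−1/2} = a⁻¹` for `a ≥ 0`. [folklore] -/
private theorem sq_rpow_neg_half {a : ℝ} (ha : 0 ≤ a) : (a ^ 2) ^ (-(1 / 2 : ℝ)) = a⁻¹ := by
  rw [rpow_neg_half (sq_nonneg a), Real.sqrt_sq ha]

/-- The rational identity behind the pull-back, in six free non-zero quantities
`p = √A`, `q = √B`, `r = √C`, `s = √D`, `a`, `b`:
`4ab · ¼ (a p q b r s)⁻¹ (q² + s² − 1) = (1/(pq))(s/r) + (q/p)(1/(rs)) − (1/(pq))(1/(rs))`.
[folklore] -/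
private theorem pullback_core (p q r s a b : ℝ) (hp : p ≠ 0) (hq : q ≠ 0) (hr : r ≠ 0)
    (hs : s ≠ 0) (ha : a ≠ 0) (hb : b ≠ 0) :
    4 * a * b * (1 / 4 * (a⁻¹ * p⁻¹ * q⁻¹ * b⁻¹ * r⁻¹ * s⁻¹ * (q ^ 2 + s ^ 2 - 1))) =
      1 / (p * q) * (s / r) + q / p * (1 / (r * s)) - 1 / (p * q) * (1 / (r * s)) := by
  field_simp
  ring

/-- **The pull-back identity.** For `m, a, b ∈ (0,1)`:
`4ab · ¼ K(a², b²) (1 − m a² − (1−m) b²) = F(m; a, b)` (Legendre's form), where `K` is the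
Elliott kernel; i.e. `κₘ(a) = (1−a²)^{−1/2}(1−ma²)^{−1/2}`, `eₘ(a) = (1−ma²) κₘ(a)` and
`e κ' + κ e' − κ κ' = κ κ' (B + D − 1)`. [cite: KontsevichZagier2001, §1.2] -/
private theorem legendre_pullback {m a b : ℝ} (hm : m ∈ Ioo (0:ℝ) 1) (ha : a ∈ Ioo (0:ℝ) 1)
    (hb : b ∈ Ioo (0:ℝ) 1) :
    4 * a * b * (1 / 4 * ((a ^ 2) ^ (-(1 / 2 : ℝ)) * (1 - a ^ 2) ^ (-(1 / 2 : ℝ)) *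
        (1 - m * a ^ 2) ^ (-(1 / 2 : ℝ)) * (b ^ 2) ^ (-(1 / 2 : ℝ)) * (1 - b ^ 2) ^ (-(1 / 2 : ℝ)) *
        (1 - (1 - m) * b ^ 2) ^ (-(1 / 2 : ℝ)) * (1 - m * a ^ 2 - (1 - m) * b ^ 2))) =
      1 / Real.sqrt ((1 - a ^ 2) * (1 - m * a ^ 2)) *
          (Real.sqrt (1 - (1 - m) * b ^ 2) / Real.sqrt (1 - b ^ 2)) +
        Real.sqrt (1 - m * a ^ 2) / Real.sqrt (1 - a ^ 2) *
          (1 / Real.sqrt ((1 - b ^ 2) * (1 - (1 - m) * b ^ 2))) -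
        1 / Real.sqrt ((1 - a ^ 2) * (1 - m * a ^ 2)) *
          (1 / Real.sqrt ((1 - b ^ 2) * (1 - (1 - m) * b ^ 2))) := by
  have hA : 0 < 1 - a ^ 2 := by nlinarith [ha.1, ha.2]
  have hB : 0 < 1 - m * a ^ 2 := by nlinarith [hA, mul_pos (sub_pos.2 hm.2) (pow_pos ha.1 2)]
  have hC : 0 < 1 - b ^ 2 := by nlinarith [hb.1, hb.2]
  have hD : 0 < 1 - (1 - m) * b ^ 2 := by nlinarith [hC, mul_pos hm.1 (pow_pos hb.1 2)]
  have hlin : 1 - m * a ^ 2 - (1 - m) * b ^ 2 =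
      Real.sqrt (1 - m * a ^ 2) ^ 2 + Real.sqrt (1 - (1 - m) * b ^ 2) ^ 2 - 1 := by
    rw [Real.sq_sqrt hB.le, Real.sq_sqrt hD.le]
    ring
  rw [hlin, Real.sqrt_mul hA.le, Real.sqrt_mul hC.le, sq_rpow_neg_half ha.1.le,
    sq_rpow_neg_half hb.1.le, rpow_neg_half hA.le, rpow_neg_half hB.le, rpow_neg_half hC.le,
    rpow_neg_half hD.le]
  exact pullback_core _ _ _ _ _ _ (Real.sqrt_pos.2 hA).ne' (Real.sqrt_pos.2 hB).ne'
    (Real.sqrt_pos.2 hC).ne' (Real.sqrt_pos.2 hD).ne' ha.1.ne' hb.1.ne'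

/-! ## The chart `Φ(x) = (x₀², x₁²)` of `ℝ²` -/

/-- `Φ` has derivative `diag(2x₀, 2x₁)` everywhere (coordinatewise `(t²)' = 2t`). [folklore] -/
private theorem sq_hasFDerivAt (x : Fin 2 → ℝ) :
    HasFDerivAt (fun y : Fin 2 → ℝ => fun i => y i ^ 2)
      (LinearMap.toContinuousLinearMap
        (Matrix.toLin' (Matrix.diagonal fun i : Fin 2 => 2 * x i))) x := by
  rw [hasFDerivAt_pi']
  intro i
  have h0 : HasFDerivAt (fun f : Fin 2 → ℝ => f i)
      (ContinuousLinearMap.proj (R := ℝ) (φ := fun _ : Fin 2 => ℝ) i) x :=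
    hasFDerivAt_apply i x
  refine ((hasDerivAt_pow 2 (x i)).comp_hasFDerivAt x h0).congr_fderiv
    (ContinuousLinearMap.ext fun v => ?_)
  fin_cases i <;> simp

/-- The Jacobian determinant of `Φ` is `det diag(2x₀, 2x₁) = 4 x₀ x₁`. [folklore] -/
private theorem sq_det (x : Fin 2 → ℝ) :
    (LinearMap.toContinuousLinearMap
        (Matrix.toLin' (Matrix.diagonal fun i : Fin 2 => 2 * x i))).det = 4 * x 0 * x 1 := by
  simp [LinearMap.det_toLin', Matrix.det_diagonal, Fin.prod_univ_two]
  ring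

/-- `Φ` is injective on the open square (squares of positive numbers). [folklore] -/
private theorem sq_injOn :
    InjOn (fun y : Fin 2 → ℝ => fun i => y i ^ 2) {x : Fin 2 → ℝ | ∀ i, x i ∈ Ioo (0:ℝ) 1} := by
  intro x hx y hy hxy
  funext i
  have h : x i ^ 2 = y i ^ 2 := congrFun hxy i
  exact (pow_left_inj₀ (hx i).1.le (hy i).1.le two_ne_zero).1 h

/-- `Φ` maps the open square ONTO itself (onto by coordinatewise square roots). [folklore] -/
private theorem sq_image :
    (fun y : Fin 2 → ℝ => fun i => y i ^ 2) '' {x : Fin 2 → ℝ | ∀ i, x i ∈ Ioo (0:ℝ) 1} =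
      {x : Fin 2 → ℝ | ∀ i, x i ∈ Ioo (0:ℝ) 1} := by
  ext y
  constructor
  · rintro ⟨x, hx, rfl⟩ i
    have hxi : x i ∈ Ioo (0:ℝ) 1 := hx i
    exact ⟨pow_pos hxi.1 2, pow_lt_one₀ hxi.1.le hxi.2 two_ne_zero⟩
  · intro hy
    have hy' : ∀ i, y i ∈ Ioo (0:ℝ) 1 := hy
    refine ⟨fun i => Real.sqrt (y i), fun i => ⟨Real.sqrt_pos.2 (hy' i).1, ?_⟩,
      funext fun i => Real.sq_sqrt (hy' i).1.le⟩
    rw [Real.sqrt_lt' one_pos, one_pow]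
    exact (hy' i).2

/-- `Φ` is a `ℚ`-semialgebraic map on the open square (a `ℚ`-polynomial map).
[cite: BochnakCosteRoy1998, Prop. 2.2.6] -/
private theorem sq_isSemialgebraicMapOn :
    IsSemialgebraicMapOn ℚ {x : Fin 2 → ℝ | ∀ i, x i ∈ Ioo (0:ℝ) 1}
      (fun y : Fin 2 → ℝ => fun i => y i ^ 2) :=
  (isSemialgebraicMapOn_aeval (isSemialgebraic_box 2)
    (fun j => (X j : MvPolynomial (Fin 2) ℚ) ^ 2)).congr fun x _ => funext fun j => by simp

/-! ## The quarter-Elliott integrand is `ℚ`-semialgebraic on the open square -/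

/-- For real algebraic `m ∈ (0,1)` the function
`¼ t^{−1/2}(1−t)^{−1/2}(1−mt)^{−1/2} u^{−1/2}(1−u)^{−1/2}(1−(1−m)u)^{−1/2} · (1 − mt − (1−m)u)` is
`ℚ`-semialgebraic on `(0,1)²`: a product of rational powers of POSITIVE `ℚ(m)`-affine functions
(`IsSemialgebraicFunOn.rpow_ratCast`) and an affine factor. [cite: BochnakCosteRoy1998, Prop. 2.2.6] -/
private theorem isSemialgebraicFunOn_quarterElliott {m : ℝ} (hma : IsAlgebraic ℚ m)
    (hm : m ∈ Ioo (0:ℝ) 1) :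
    IsSemialgebraicFunOn ℚ {x : Fin 2 → ℝ | ∀ i, x i ∈ Ioo (0:ℝ) 1}
      (fun x : Fin 2 → ℝ => 1 / 4 * ((x 0 ^ (-(1 / 2 : ℝ)) * (1 - x 0) ^ (-(1 / 2 : ℝ)) *
        (1 - m * x 0) ^ (-(1 / 2 : ℝ)) * x 1 ^ (-(1 / 2 : ℝ)) * (1 - x 1) ^ (-(1 / 2 : ℝ)) *
        (1 - (1 - m) * x 1) ^ (-(1 / 2 : ℝ))) * (1 - m * x 0 - (1 - m) * x 1))) := by
  have hS : IsSemialgebraic ℚ {x : Fin 2 → ℝ | ∀ i, x i ∈ Ioo (0:ℝ) 1} := isSemialgebraic_box 2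
  have hcast : (((-1 / 2 : ℚ)) : ℝ) = -(1 / 2 : ℝ) := by norm_num
  -- atoms
  have h1 : IsSemialgebraicFunOn ℚ {x : Fin 2 → ℝ | ∀ i, x i ∈ Ioo (0:ℝ) 1} (fun _ => (1:ℝ)) :=
    (isSemialgebraicFunOn_aeval hS (1 : MvPolynomial (Fin 2) ℚ)).congr fun x _ => by simp
  have hq : IsSemialgebraicFunOn ℚ {x : Fin 2 → ℝ | ∀ i, x i ∈ Ioo (0:ℝ) 1} (fun _ => (1 / 4 : ℝ)) :=
    (isSemialgebraicFunOn_aeval hS (C (1 / 4) : MvPolynomial (Fin 2) ℚ)).congr fun x _ => by simp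
  have hmc : IsSemialgebraicFunOn ℚ {x : Fin 2 → ℝ | ∀ i, x i ∈ Ioo (0:ℝ) 1} (fun _ => m) :=
    isSemialgebraicFunOn_const_of_isAlgebraic hS hma
  have hx0 : IsSemialgebraicFunOn ℚ {x : Fin 2 → ℝ | ∀ i, x i ∈ Ioo (0:ℝ) 1} (fun x => x 0) :=
    (isSemialgebraicFunOn_aeval hS (X 0)).congr fun x _ => by simp
  have hx1 : IsSemialgebraicFunOn ℚ {x : Fin 2 → ℝ | ∀ i, x i ∈ Ioo (0:ℝ) 1} (fun x => x 1) :=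
    (isSemialgebraicFunOn_aeval hS (X 1)).congr fun x _ => by simp
  -- the affine factors
  have hA : IsSemialgebraicFunOn ℚ {x : Fin 2 → ℝ | ∀ i, x i ∈ Ioo (0:ℝ) 1} (fun x => 1 - x 0) :=
    (IsSemialgebraicFunOn.sub_holds h1 hx0).congr fun _ _ => rfl
  have hB : IsSemialgebraicFunOn ℚ {x : Fin 2 → ℝ | ∀ i, x i ∈ Ioo (0:ℝ) 1} (fun x => 1 - m * x 0) :=
    (IsSemialgebraicFunOn.sub_holds h1 (IsSemialgebraicFunOn.mul_holds hmc hx0)).congr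
      fun _ _ => rfl
  have hC : IsSemialgebraicFunOn ℚ {x : Fin 2 → ℝ | ∀ i, x i ∈ Ioo (0:ℝ) 1} (fun x => 1 - x 1) :=
    (IsSemialgebraicFunOn.sub_holds h1 hx1).congr fun _ _ => rfl
  have hD : IsSemialgebraicFunOn ℚ {x : Fin 2 → ℝ | ∀ i, x i ∈ Ioo (0:ℝ) 1}
      (fun x => 1 - (1 - m) * x 1) :=
    (IsSemialgebraicFunOn.sub_holds h1 (IsSemialgebraicFunOn.mul_holds
      (IsSemialgebraicFunOn.sub_holds h1 hmc) hx1)).congr fun _ _ => rfl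
  have hL : IsSemialgebraicFunOn ℚ {x : Fin 2 → ℝ | ∀ i, x i ∈ Ioo (0:ℝ) 1}
      (fun x => 1 - m * x 0 - (1 - m) * x 1) :=
    (IsSemialgebraicFunOn.sub_holds hB (IsSemialgebraicFunOn.mul_holds
      (IsSemialgebraicFunOn.sub_holds h1 hmc) hx1)).congr fun _ _ => rfl
  -- positivity of the atoms on the open square
  have p0 : ∀ x ∈ {x : Fin 2 → ℝ | ∀ i, x i ∈ Ioo (0:ℝ) 1}, 0 < x 0 := fun x hx => (hx 0).1
  have p1 : ∀ x ∈ {x : Fin 2 → ℝ | ∀ i, x i ∈ Ioo (0:ℝ) 1}, 0 < x 1 := fun x hx => (hx 1).1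
  have pA : ∀ x ∈ {x : Fin 2 → ℝ | ∀ i, x i ∈ Ioo (0:ℝ) 1}, 0 < 1 - x 0 := fun x hx =>
    sub_pos.2 (hx 0).2
  have pB : ∀ x ∈ {x : Fin 2 → ℝ | ∀ i, x i ∈ Ioo (0:ℝ) 1}, 0 < 1 - m * x 0 := fun x hx => by
    nlinarith [hm.1, hm.2, (hx 0).1, (hx 0).2]
  have pC : ∀ x ∈ {x : Fin 2 → ℝ | ∀ i, x i ∈ Ioo (0:ℝ) 1}, 0 < 1 - x 1 := fun x hx =>
    sub_pos.2 (hx 1).2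
  have pD : ∀ x ∈ {x : Fin 2 → ℝ | ∀ i, x i ∈ Ioo (0:ℝ) 1}, 0 < 1 - (1 - m) * x 1 := fun x hx => by
    nlinarith [hm.1, hm.2, (hx 1).1, (hx 1).2]
  -- the six rational powers
  have r0 := IsSemialgebraicFunOn.rpow_ratCast hS hx0 p0 (-1 / 2)
  have rA := IsSemialgebraicFunOn.rpow_ratCast hS hA pA (-1 / 2)
  have rB := IsSemialgebraicFunOn.rpow_ratCast hS hB pB (-1 / 2)
  have r1 := IsSemialgebraicFunOn.rpow_ratCast hS hx1 p1 (-1 / 2)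
  have rC := IsSemialgebraicFunOn.rpow_ratCast hS hC pC (-1 / 2)
  have rD := IsSemialgebraicFunOn.rpow_ratCast hS hD pD (-1 / 2)
  rw [hcast] at r0 rA rB r1 rC rD
  have hK := IsSemialgebraicFunOn.mul_holds (IsSemialgebraicFunOn.mul_holds
    (IsSemialgebraicFunOn.mul_holds (IsSemialgebraicFunOn.mul_holds
    (IsSemialgebraicFunOn.mul_holds r0 rA) rB) r1) rC) rD
  exact (IsSemialgebraicFunOn.mul_holds hq (IsSemialgebraicFunOn.mul_holds hK hL)).congr
    fun _ _ => rfl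

/-! ## The stub -/

/-- **Registered stub `stub_legendreSquareCoV`** (line `cusp-transport-to-the-beta-world` of crux
stmt-KontsevichZagierPeriods-14233, link S1 of the `LegendreSector` chain): ONE change of
variables `(x, y) ↦ (x², y²)` on `(0,1)²` (`|det| = 4xy`): Legendre's form `F(m; x, y)` on
`(0,1)²` is equivalent, in the Kontsevich–Zagier calculus, to a quarter of the Elliott integrand
`K (1 − mt − (1−m)u)` with `a = ½`, `c = 1` (`κₘ(√t) = (1−t)^{−1/2}(1−mt)^{−1/2}`,
`eₘ = (1−mt) κₘ`, `e κ' + κ e' − κ κ' = κ κ' (B + D − 1)`), at every real algebraic modulus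
`m ∈ (0,1)`. [cite: KontsevichZagier2001, §1.2] -/
theorem stub_legendreSquareCoV :
    ∀ (F : ℝ → (Fin 2 → ℝ) → ℝ), (∀ (m : ℝ) (x : Fin 2 → ℝ), F m x = 1 / Real.sqrt ((1 - x 0 ^ 2) * (1 - m * x 0 ^ 2)) * (Real.sqrt (1 - (1 - m) * x 1 ^ 2) / Real.sqrt (1 - x 1 ^ 2)) + Real.sqrt (1 - m * x 0 ^ 2) / Real.sqrt (1 - x 0 ^ 2) * (1 / Real.sqrt ((1 - x 1 ^ 2) * (1 - (1 - m) * x 1 ^ 2))) - 1 / Real.sqrt ((1 - x 0 ^ 2) * (1 - m * x 0 ^ 2)) * (1 / Real.sqrt ((1 - x 1 ^ 2) * (1 - (1 - m) * x 1 ^ 2)))) → ∀ (m : ℝ), IsAlgebraic ℚ m → m ∈ Set.Ioo (0 : ℝ) 1 → ∀ (r : IntegralRep 2), r.domain = {x | ∀ i, x i ∈ Set.Ioo (0 : ℝ) 1} → Set.EqOn r.integrand (F m) r.domain → ∃ R : IntegralRep 2, R.domain = {x | ∀ i, x i ∈ Set.Ioo (0 : ℝ) 1} ∧ Set.EqOn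 R.integrand (fun x : Fin 2 → ℝ => 1 / 4 * ((x 0 ^ (-(1 / 2 : ℝ)) * (1 - x 0) ^ (-(1 / 2 : ℝ)) * (1 - m * x 0) ^ (-(1 / 2 : ℝ)) * x 1 ^ (-(1 / 2 : ℝ)) * (1 - x 1) ^ (-(1 / 2 : ℝ)) * (1 - (1 - m) * x 1) ^ (-(1 / 2 : ℝ))) * (1 - m * x 0 - (1 - m) * x 1))) R.domain ∧ Equivalent r R := by
  intro F hF m hma hm r hrd hri
  have hS : IsSemialgebraic ℚ {x : Fin 2 → ℝ | ∀ i, x i ∈ Ioo (0:ℝ) 1} := isSemialgebraic_box 2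
  have hSm : MeasurableSet {x : Fin 2 → ℝ | ∀ i, x i ∈ Ioo (0:ℝ) 1} :=
    measurableSet_setOf_forall_apply_mem_Ioo 2
  -- the pull-back identity on the open square
  have hpull : ∀ x ∈ {x : Fin 2 → ℝ | ∀ i, x i ∈ Ioo (0:ℝ) 1},
      |(LinearMap.toContinuousLinearMap
          (Matrix.toLin' (Matrix.diagonal fun i : Fin 2 => 2 * x i))).det| *
        (1 / 4 * (((x 0 ^ 2) ^ (-(1 / 2 : ℝ)) * (1 - x 0 ^ 2) ^ (-(1 / 2 : ℝ)) *
          (1 - m * x 0 ^ 2) ^ (-(1 / 2 : ℝ)) * (x 1 ^ 2) ^ (-(1 / 2 : ℝ)) *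
          (1 - x 1 ^ 2) ^ (-(1 / 2 : ℝ)) * (1 - (1 - m) * x 1 ^ 2) ^ (-(1 / 2 : ℝ))) *
          (1 - m * x 0 ^ 2 - (1 - m) * x 1 ^ 2))) = F m x := by
    intro x hx
    have hx0 : 0 < x 0 := (hx 0).1
    have hx1 : 0 < x 1 := (hx 1).1
    rw [hF, sq_det, abs_of_pos (by positivity)]
    exact legendre_pullback hm (hx 0) (hx 1)
  have hderiv : ∀ x ∈ {x : Fin 2 → ℝ | ∀ i, x i ∈ Ioo (0:ℝ) 1},
      HasFDerivWithinAt (fun y : Fin 2 → ℝ => fun i => y i ^ 2)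
        (LinearMap.toContinuousLinearMap
          (Matrix.toLin' (Matrix.diagonal fun i : Fin 2 => 2 * x i)))
        {x : Fin 2 → ℝ | ∀ i, x i ∈ Ioo (0:ℝ) 1} x := fun x _ =>
    (sq_hasFDerivAt x).hasFDerivWithinAt
  -- integrability of the target integrand on `S = Φ '' S`, transported from `r`
  have hint : IntegrableOn
      (fun x : Fin 2 → ℝ => 1 / 4 * ((x 0 ^ (-(1 / 2 : ℝ)) * (1 - x 0) ^ (-(1 / 2 : ℝ)) *
        (1 - m * x 0) ^ (-(1 / 2 : ℝ)) * x 1 ^ (-(1 / 2 : ℝ)) * (1 - x 1) ^ (-(1 / 2 : ℝ)) *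
        (1 - (1 - m) * x 1) ^ (-(1 / 2 : ℝ))) * (1 - m * x 0 - (1 - m) * x 1)))
      {x : Fin 2 → ℝ | ∀ i, x i ∈ Ioo (0:ℝ) 1} := by
    have h := (integrableOn_image_iff_integrableOn_abs_det_fderiv_smul volume hSm hderiv sq_injOn
      (fun x : Fin 2 → ℝ => 1 / 4 * ((x 0 ^ (-(1 / 2 : ℝ)) * (1 - x 0) ^ (-(1 / 2 : ℝ)) *
        (1 - m * x 0) ^ (-(1 / 2 : ℝ)) * x 1 ^ (-(1 / 2 : ℝ)) * (1 - x 1) ^ (-(1 / 2 : ℝ)) *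
        (1 - (1 - m) * x 1) ^ (-(1 / 2 : ℝ))) * (1 - m * x 0 - (1 - m) * x 1)))).mpr ?_
    · rwa [sq_image] at h
    · have hr : IntegrableOn r.integrand {x : Fin 2 → ℝ | ∀ i, x i ∈ Ioo (0:ℝ) 1} :=
        hrd ▸ r.integrableOn
      refine hr.congr_fun (fun x hx => ?_) hSm
      rw [hri (hrd ▸ hx), smul_eq_mul]
      exact (hpull x hx).symm
  -- the target representation, assembled in place, and the single change-of-variables move
  refine ⟨⟨{x : Fin 2 → ℝ | ∀ i, x i ∈ Ioo (0:ℝ) 1},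
      fun x : Fin 2 → ℝ => 1 / 4 * ((x 0 ^ (-(1 / 2 : ℝ)) * (1 - x 0) ^ (-(1 / 2 : ℝ)) *
        (1 - m * x 0) ^ (-(1 / 2 : ℝ)) * x 1 ^ (-(1 / 2 : ℝ)) * (1 - x 1) ^ (-(1 / 2 : ℝ)) *
        (1 - (1 - m) * x 1) ^ (-(1 / 2 : ℝ))) * (1 - m * x 0 - (1 - m) * x 1)),
      hS, isSemialgebraicFunOn_quarterElliott hma hm, hint⟩, rfl, fun _ _ => rfl, ?_⟩
  refine changeOfVariablesRel_subset_relations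
    ⟨2, r, _, fun y : Fin 2 → ℝ => fun i => y i ^ 2,
      fun x => LinearMap.toContinuousLinearMap
        (Matrix.toLin' (Matrix.diagonal fun i : Fin 2 => 2 * x i)),
      ?_, ?_, ?_, ?_, fun x hx => ?_, rfl⟩
  · rw [hrd]
    exact sq_isSemialgebraicMapOn
  · rw [hrd]
    exact hderiv
  · rw [hrd]
    exact sq_injOn
  · show {x : Fin 2 → ℝ | ∀ i, x i ∈ Ioo (0:ℝ) 1} = _ '' r.domain
    rw [hrd, sq_image]
  · have hx' : x ∈ {x : Fin 2 → ℝ | ∀ i, x i ∈ Ioo (0:ℝ) 1} := hrd ▸ hx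
    show r.integrand x = 1 / 4 * (((x 0 ^ 2) ^ (-(1 / 2 : ℝ)) * (1 - x 0 ^ 2) ^ (-(1 / 2 : ℝ)) *
          (1 - m * x 0 ^ 2) ^ (-(1 / 2 : ℝ)) * (x 1 ^ 2) ^ (-(1 / 2 : ℝ)) *
          (1 - x 1 ^ 2) ^ (-(1 / 2 : ℝ)) * (1 - (1 - m) * x 1 ^ 2) ^ (-(1 / 2 : ℝ))) *
          (1 - m * x 0 ^ 2 - (1 - m) * x 1 ^ 2)) *
      |(LinearMap.toContinuousLinearMap
          (Matrix.toLin' (Matrix.diagonal fun i : Fin 2 => 2 * x i))).det|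
    rw [hri hx, mul_comm]
    exact (hpull x hx').symm

end Summit.KontsevichZagierPeriods.KontsevichZagierPeriods.CompleteModGammaSectorEngine
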